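import Literature.NumberTheory.Automorphic.AdelicHeightGLContinuity
import Literature.NumberTheory.Automorphic.LeviEmbeddingGLHeight
import Literature.NumberTheory.Automorphic.AdelicSecondCountable
import Literature.NumberTheory.Automorphic.GLnAdelicLocallyCompact
import Summits.HodgeConjecture.HodgeConjecture.Theorems.K2LiuSmearingVolumeBound
import HarnessLib

/-!
# Volume growth of height balls in a closed subgroup of `GL_N(𝔸_L)` is dominated by a height box of `GL_N(𝔸_L)`

Track B ∕ hLiu418 = stmt-HodgeConjecture-24832, line `K2_Liu_CurveThetaSigs`, unit U5 «DOUBLING ZETA», organ (IV-d) of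
socket #16b `sig_K2LiuAdelicNormIntegrable` (`Cruxes/HLiu418/Lines/K2_Liu_CurveThetaSigs_U5_DoublingZeta.lean`, ED. 5); seat
`hodgecm-mathlib-K2Liu-p03` (g2), plan `K2/K2Liu-p03/g2/PLAN-16b-AdelicNormIntegrable.v1.K2Liu-p03-g2.md`, FILE 5 of 6
(the concrete «smearing» step; FILE 1 = ★ `Theorems/K2LiuSmearingVolumeBound`).

Let `G ≤ GL_N(𝔸_L)` be a CLOSED subgroup with a Haar measure `ν`, and `μ` a Haar measure on `GL_N(𝔸_L)`; write
`‖g‖ = H_∞(g) · ∏_v H_v(g)` for the adelic height (★ `adelicHeightGL`, `GLn.archHeight`, `GLn.localHeight` of `AdelicGLnGlue`).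
MAIN THEOREM `exists_measure_heightBall_le`: **there are `C < ∞` and `B₁, B₂ ≥ 0` with
`ν{g ∈ G : ‖g‖ ≤ T} ≤ C · μ{y ∈ GL_N(𝔸_L) : H_∞(y) ≤ B₁ T ∧ ∏_v H_v(y) ≤ B₂ T}` for every real `T`.**
Proof: smear `G` into `GL_N(𝔸_L)` through a compact neighbourhood `Ω` of `1` — apply ★
`K2LiuSmearingVolumeBound.mul_measure_le_of_smearing` to the relation `g⁻¹ y ∈ Ω`: its sections `g Ω` have `μ`-measure
`μ(Ω) > 0` (left invariance — NO module computation), its fibres lie in a left translate of the compact `G ∩ Ω Ω⁻¹`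
(`G` closed), and `y = g ω` with `‖g‖ ≤ T`, `ω ∈ Ω` has `H_∞(y) ≤ N H_∞(g) H_∞(ω) ≤ N B_∞ T` and
`∏ H_v(y) ≤ ∏ H_v(g) ∏ H_v(ω) ≤ N B_f T` (★ `GLn.archHeight_mul_le`, ★ `GLn.finprod_localHeight_mul_le`, and the bookkeeping
`H_∞ ≤ ‖·‖`, `∏ H_v ≤ N ‖·‖` of §1, from ★ `GLn.one_le_finprod_localHeight`, ★ `GLn.one_le_mul_archHeight_sq`). No structure
theory of `G` is used (no Cartan ∕ Iwasawa decomposition at any place, no restricted product); the only input on `G` is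
closedness. The height box of `GL_N(𝔸_L)` on the right is measured in the sequel files (archimedean volume via ★ `coordHaarGL`,
finite coset count), giving Weil's polynomial volume growth and, by ★ `integrable_rpow_neg_of_measure_le`, the integrability of
`‖·‖^{-β}` on `G` [Weil, *Basic Number Theory* VII §3; Borel–Jacquet §1.2; Moeglin–Waldspurger I.2.2].

* §1 `one_le_mul_archHeight`, `finprod_localHeight_le_mul_adelicHeightGL` — `1 ≤ N H_∞`, `∏ H_v ≤ N ‖·‖`
  (`H_∞ ≤ ‖·‖` is ★ `archHeight_le_adelicHeightGL` of `GodementJacquetSingularMajorant`, inlined here to keep imports light).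
* §2 `exists_measure_heightBall_le` — the main theorem.

No definition, no instance, no named fact; axioms ⊆ {propext, Classical.choice, Quot.sound}.

## References
* A. Weil, *Basic Number Theory* (1967), Ch. VII §3 [WeilBNT1967].
* A. Borel, H. Jacquet, *Automorphic forms and automorphic representations*, PSPM 33.1 (1979), §1.2 [BorelJacquet1979].
* C. Moeglin, J.-L. Waldspurger, *Spectral decomposition and Eisenstein series* (1995), §I.2.2 [MoeglinWaldspurger1995].

HONEST LABEL: HC_CM is proved only modulo the 7 printed citations (2 remaining named inputs: hLiu418 =
stmt-HodgeConjecture-24832, h413 = stmt-HodgeConjecture-24833) until rung 0 closes; this helper moves no counter.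
-/

noncomputable section

set_option autoImplicit false

set_option linter.dupNamespace false

open MeasureTheory Set Filter Topology NumberField NumberField.mixedEmbedding IsDedekindDomain
open scoped ENNReal NNReal Pointwise RestrictedProduct

namespace Summit.HodgeConjecture.HodgeConjecture.Cruxes.HLiu418.K2LiuClosedSubgroupHeightBallVolume

open Literature.NumberTheory.Automorphic
open Summit.HodgeConjecture.HodgeConjecture.Cruxes.HLiu418.K2LiuSmearingVolumeBound

variable {N : ℕ} {L : Type} [Field L] [NumberField L]

/-! ## §1 Height bookkeeping: `1 ≤ N·H_∞`, `∏_v H_v ≤ N·‖·‖` -/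

/-- **`1 ≤ N · H_∞(g)`** (`N ≥ 1`): from ★ `1 ≤ N H_∞(g)²` — if `H_∞ ≥ 1` then `N H_∞ ≥ 1`, else `H_∞² ≤ H_∞`.
[cite: BorelJacquet1979, §1.2] -/
theorem one_le_mul_archHeight [NeZero N] (g : GL (Fin N) (AdeleRing (𝓞 L) L)) :
    (1 : ℝ) ≤ N * (GLn.archHeight N L g : ℝ) := by
  have hsq := GLn.one_le_mul_archHeight_sq (K := L) g
  have hN : (1 : ℝ) ≤ N := by exact_mod_cast Nat.one_le_iff_ne_zero.2 (NeZero.ne N)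
  have hH : 0 ≤ (GLn.archHeight N L g : ℝ) := NNReal.coe_nonneg _
  by_cases h1 : 1 ≤ (GLn.archHeight N L g : ℝ)
  · calc (1 : ℝ) = 1 * 1 := (mul_one 1).symm
      _ ≤ N * (GLn.archHeight N L g : ℝ) := mul_le_mul hN h1 zero_le_one (zero_le_one.trans hN)
  · have hlt : (GLn.archHeight N L g : ℝ) ≤ 1 := (not_le.1 h1).le
    calc (1 : ℝ) ≤ N * (GLn.archHeight N L g : ℝ) ^ 2 := hsq
      _ ≤ N * (GLn.archHeight N L g : ℝ) := by
          rw [sq]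
          exact mul_le_mul_of_nonneg_left (mul_le_of_le_one_left hH hlt) (zero_le_one.trans hN)

/-- **`∏_v H_v(g) ≤ N · ‖g‖`** (`N ≥ 1`): `∏ H_v ≤ (N H_∞) ∏ H_v = N ‖g‖`. [cite: BorelJacquet1979, §1.2] -/
theorem finprod_localHeight_le_mul_adelicHeightGL [NeZero N] (g : GL (Fin N) (AdeleRing (𝓞 L) L)) :
    ∏ᶠ v, (GLn.localHeight N L v g : ℝ) ≤ N * adelicHeightGL N L g := by
  have hf : 0 ≤ ∏ᶠ v, (GLn.localHeight N L v g : ℝ) := finprod_nonneg fun _ => NNReal.coe_nonneg _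
  calc ∏ᶠ v, (GLn.localHeight N L v g : ℝ) = 1 * ∏ᶠ v, (GLn.localHeight N L v g : ℝ) := (one_mul _).symm
    _ ≤ (N * (GLn.archHeight N L g : ℝ)) * ∏ᶠ v, (GLn.localHeight N L v g : ℝ) :=
        mul_le_mul_of_nonneg_right (one_le_mul_archHeight g) hf
    _ = N * adelicHeightGL N L g := by rw [adelicHeightGL, mul_assoc]

/-! ## §2 The smearing of a closed subgroup into `GL_N(𝔸_L)` -/

/-- **Volume growth of height balls in a closed subgroup is dominated by a height box of `GL_N(𝔸_L)`.** Let `G ≤ GL_N(𝔸_L)`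
be closed, `ν` a Haar measure on `G`, `μ` a Haar measure on `GL_N(𝔸_L)` (`N ≥ 1`). There are `C < ∞` and `B₁, B₂ ≥ 0` such
that for every real `T`,
`ν{g ∈ G : ‖g‖ ≤ T} ≤ C · μ{y : H_∞(y) ≤ B₁ T ∧ ∏_v H_v(y) ≤ B₂ T}`.
Smearing through a compact neighbourhood `Ω` of `1` (★ `mul_measure_le_of_smearing` with the relation `g⁻¹y ∈ Ω`):
sections `g Ω` have measure `μ(Ω) > 0` by left invariance, fibres lie in a translate of the compact `G ∩ Ω Ω⁻¹`, and
`y = g ω` has `H_∞(y) ≤ N H_∞(g) H_∞(ω)`, `∏ H_v(y) ≤ ∏ H_v(g) ∏ H_v(ω)` with `H_∞(g) ≤ ‖g‖ ≤ T`, `∏ H_v(g) ≤ N ‖g‖`;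
`C = ν(G ∩ Ω Ω⁻¹) ∕ μ(Ω)`, `B₁ = N sup_Ω H_∞`, `B₂ = N sup_Ω ∏ H_v`. [cite: WeilBNT1967, Ch. VII §3] [cite: MoeglinWaldspurger1995, §I.2.2] -/
theorem exists_measure_heightBall_le [NeZero N]
    [MeasurableSpace (GL (Fin N) (AdeleRing (𝓞 L) L))] [BorelSpace (GL (Fin N) (AdeleRing (𝓞 L) L))]
    (μ : Measure (GL (Fin N) (AdeleRing (𝓞 L) L))) [μ.IsHaarMeasure]
    (G : Subgroup (GL (Fin N) (AdeleRing (𝓞 L) L))) (hG : IsClosed (G : Set (GL (Fin N) (AdeleRing (𝓞 L) L))))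
    [MeasurableSpace G] [BorelSpace G] (ν : Measure G) [ν.IsHaarMeasure] :
    ∃ (C : ℝ≥0∞) (B₁ B₂ : ℝ), C ≠ ∞ ∧ 0 ≤ B₁ ∧ 0 ≤ B₂ ∧ ∀ T : ℝ,
      ν {g : G | adelicHeightGL N L (g : GL (Fin N) (AdeleRing (𝓞 L) L)) ≤ T} ≤
        C * μ {y : GL (Fin N) (AdeleRing (𝓞 L) L) |
          (GLn.archHeight N L y : ℝ) ≤ B₁ * T ∧ ∏ᶠ v, (GLn.localHeight N L v y : ℝ) ≤ B₂ * T} := by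
  classical
  -- topology of `GL_N(𝔸_L)`: Hausdorff, locally compact, second countable
  haveI : T2Space (FiniteAdeleRing (𝓞 L) L) := inferInstanceAs <| T2Space
    (Πʳ w : HeightOneSpectrum (𝓞 L), [w.adicCompletion L, w.adicCompletionIntegers L])
  haveI : T2Space (InfiniteAdeleRing L) :=
    inferInstanceAs <| T2Space ((w : InfinitePlace L) → w.Completion)
  haveI : T2Space (AdeleRing (𝓞 L) L) :=
    inferInstanceAs <| T2Space (InfiniteAdeleRing L × FiniteAdeleRing (𝓞 L) L)
  haveI : LocallyCompactSpace (GL (Fin N) (AdeleRing (𝓞 L) L)) :=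
    AdelicGroupData.locallyCompactSpace_generalLinearGroup_adeleRing (K := L) (ι := Fin N)
  haveI : SecondCountableTopology (GL (Fin N) (AdeleRing (𝓞 L) L)) :=
    secondCountableTopology_generalLinearGroup_adeleRing L (Fin N)
  haveI : SecondCountableTopology G := hG.isClosedEmbedding_subtypeVal.isEmbedding.secondCountableTopology
  haveI : LocallyCompactSpace G := hG.isClosedEmbedding_subtypeVal.locallyCompactSpace
  haveI : SigmaCompactSpace G := sigmaCompactSpace_of_locallyCompact_secondCountable
  -- the smearing window: a compact neighbourhood `Ω` of `1`
  obtain ⟨Ω, hΩc, hΩ1⟩ := exists_compact_mem_nhds (1 : GL (Fin N) (AdeleRing (𝓞 L) L))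
  have hΩmeas : MeasurableSet Ω := hΩc.isClosed.measurableSet
  have hκpos : μ Ω ≠ 0 := (Measure.measure_pos_of_mem_nhds μ hΩ1).ne'
  have hκfin : μ Ω ≠ ∞ := hΩc.measure_lt_top.ne
  -- the fibre bound: `R = G ∩ Ω Ω⁻¹`, compact in `G`
  set R : Set G := ((↑) : G → GL (Fin N) (AdeleRing (𝓞 L) L)) ⁻¹' (Ω * Ω⁻¹) with hRdef
  have hRc : IsCompact R := hG.isClosedEmbedding_subtypeVal.isCompact_preimage (hΩc.mul hΩc.inv)
  have hRfin : ν R ≠ ∞ := hRc.measure_lt_top.ne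
  -- bounds of the two heights on `Ω`
  obtain ⟨Binf, hBinf⟩ := (hΩc.bddAbove_image (GLn.continuous_archHeight (n := N) (K := L)).continuousOn)
  obtain ⟨Bfin, hBfin⟩ := (hΩc.bddAbove_image
    (GLn.continuous_finprod_localHeight (n := N) (K := L)).continuousOn)
  rw [mem_upperBounds] at hBinf hBfin
  have hBinf' : ∀ ω ∈ Ω, (GLn.archHeight N L ω : ℝ) ≤ Binf := fun ω hω =>
    NNReal.coe_le_coe.2 (hBinf _ ⟨ω, hω, rfl⟩)
  have hBfin' : ∀ ω ∈ Ω, ∏ᶠ v, (GLn.localHeight N L v ω : ℝ) ≤ Bfin := fun ω hω => hBfin _ ⟨ω, hω, rfl⟩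
  have hBfin0 : 0 ≤ Bfin := (GLn.one_le_finprod_localHeight (1 : GL (Fin N) (AdeleRing (𝓞 L) L))).trans
    (hBfin' 1 (mem_of_mem_nhds hΩ1)) |> (zero_le_one.trans ·)
  -- the constants
  refine ⟨ν R / μ Ω, N * (Binf : ℝ), N * Bfin, ENNReal.div_lt_top hRfin hκpos |>.ne,
    by positivity, by positivity, fun T => ?_⟩
  -- the two sets
  set E : Set G := {g : G | adelicHeightGL N L (g : GL (Fin N) (AdeleRing (𝓞 L) L)) ≤ T} with hEdef
  set D : Set (GL (Fin N) (AdeleRing (𝓞 L) L)) := {y : GL (Fin N) (AdeleRing (𝓞 L) L) | (GLn.archHeight N L y : ℝ) ≤ N * (Binf : ℝ) * T ∧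
    ∏ᶠ v, (GLn.localHeight N L v y : ℝ) ≤ N * Bfin * T} with hDdef
  have hE : MeasurableSet E :=
    measurableSet_le (continuous_adelicHeightGL.comp continuous_subtype_val).measurable measurable_const
  -- the relation `g⁻¹ y ∈ Ω`
  set S : Set (G × GL (Fin N) (AdeleRing (𝓞 L) L)) := {p | ((p.1 : GL (Fin N) (AdeleRing (𝓞 L) L)))⁻¹ * p.2 ∈ Ω} with hSdef
  have hS : MeasurableSet S := by
    have hc : Continuous fun p : G × GL (Fin N) (AdeleRing (𝓞 L) L) => ((p.1 : GL (Fin N) (AdeleRing (𝓞 L) L)))⁻¹ * p.2 :=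
      (continuous_subtype_val.comp continuous_fst).inv.mul continuous_snd
    exact hΩmeas.preimage hc.measurable
  -- the three hypotheses of the smearing inequality
  have hκ : ∀ g ∈ E, μ Ω ≤ μ {y | (g, y) ∈ S} := by
    intro g _
    have : {y : GL (Fin N) (AdeleRing (𝓞 L) L) | (g, y) ∈ S} = (fun y => ((g : GL (Fin N) (AdeleRing (𝓞 L) L)))⁻¹ * y) ⁻¹' Ω := rfl
    rw [this, measure_preimage_mul]
  have hm : ∀ y, ν {g | g ∈ E ∧ (g, y) ∈ S} ≤ ν R := by
    intro y
    by_cases hy : ∃ g₀ : G, ((g₀ : GL (Fin N) (AdeleRing (𝓞 L) L)))⁻¹ * y ∈ Ω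
    · obtain ⟨g₀, hg₀⟩ := hy
      calc ν {g | g ∈ E ∧ (g, y) ∈ S} ≤ ν ((fun g : G => g₀⁻¹ * g) ⁻¹' R) := by
            refine measure_mono fun g hg => ?_
            have hgS : ((g : GL (Fin N) (AdeleRing (𝓞 L) L)))⁻¹ * y ∈ Ω := hg.2
            show ((g₀⁻¹ * g : G) : GL (Fin N) (AdeleRing (𝓞 L) L)) ∈ Ω * Ω⁻¹
            have heq : ((g₀⁻¹ * g : G) : GL (Fin N) (AdeleRing (𝓞 L) L)) = (((g₀ : GL (Fin N) (AdeleRing (𝓞 L) L)))⁻¹ * y) * (((g : GL (Fin N) (AdeleRing (𝓞 L) L)))⁻¹ * y)⁻¹ := by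
              rw [Subgroup.coe_mul, Subgroup.coe_inv, mul_inv_rev, inv_inv, ← mul_assoc, mul_assoc _ y,
                mul_inv_cancel, mul_one]
            rw [heq]
            exact Set.mul_mem_mul hg₀ (Set.inv_mem_inv.2 hgS)
        _ = ν R := measure_preimage_mul ν g₀⁻¹ R
    · have hempty : {g | g ∈ E ∧ (g, y) ∈ S} = ∅ :=
        eq_empty_of_forall_notMem fun g hg => hy ⟨g, hg.2⟩
      rw [hempty, measure_empty]
      exact bot_le
  have hD : ∀ g ∈ E, ∀ y, (g, y) ∈ S → y ∈ D := by
    intro g hg y hyS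
    have hgT : adelicHeightGL N L (g : GL (Fin N) (AdeleRing (𝓞 L) L)) ≤ T := hg
    have hω : ((g : GL (Fin N) (AdeleRing (𝓞 L) L)))⁻¹ * y ∈ Ω := hyS
    have hy : y = (g : GL (Fin N) (AdeleRing (𝓞 L) L)) * (((g : GL (Fin N) (AdeleRing (𝓞 L) L)))⁻¹ * y) := by rw [mul_inv_cancel_left]
    have hT0 : 0 ≤ T := (adelicHeightGL_nonneg _).trans hgT
    have hN0 : (0 : ℝ) ≤ N := Nat.cast_nonneg N
    refine ⟨?_, ?_⟩
    · -- archimedean: `H_∞(y) ≤ N H_∞(g) H_∞(ω) ≤ N · T · Binf`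
      have h1 : (GLn.archHeight N L y : ℝ) ≤
          N * ((GLn.archHeight N L (g : GL (Fin N) (AdeleRing (𝓞 L) L)) : ℝ) * GLn.archHeight N L (((g : GL (Fin N) (AdeleRing (𝓞 L) L)))⁻¹ * y)) := by
        have := GLn.archHeight_mul_le (g : GL (Fin N) (AdeleRing (𝓞 L) L)) (((g : GL (Fin N) (AdeleRing (𝓞 L) L)))⁻¹ * y)
        rw [← hy] at this
        exact_mod_cast this
      have h2 : (GLn.archHeight N L (g : GL (Fin N) (AdeleRing (𝓞 L) L)) : ℝ) ≤ T := (le_mul_of_one_le_right (NNReal.coe_nonneg _)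
        (GLn.one_le_finprod_localHeight (g : GL (Fin N) (AdeleRing (𝓞 L) L)))).trans hgT
      have h3 : (GLn.archHeight N L (((g : GL (Fin N) (AdeleRing (𝓞 L) L)))⁻¹ * y) : ℝ) ≤ Binf := hBinf' _ hω
      calc (GLn.archHeight N L y : ℝ)
          ≤ N * ((GLn.archHeight N L (g : GL (Fin N) (AdeleRing (𝓞 L) L)) : ℝ) * GLn.archHeight N L (((g : GL (Fin N) (AdeleRing (𝓞 L) L)))⁻¹ * y)) := h1
        _ ≤ N * (T * Binf) := by
            refine mul_le_mul_of_nonneg_left ?_ hN0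
            exact mul_le_mul h2 h3 (NNReal.coe_nonneg _) hT0
        _ = N * (Binf : ℝ) * T := by ring
    · -- finite: `∏ H_v(y) ≤ ∏ H_v(g) ∏ H_v(ω) ≤ N T · Bfin`
      have h1 : ∏ᶠ v, (GLn.localHeight N L v y : ℝ) ≤
          (∏ᶠ v, (GLn.localHeight N L v (g : GL (Fin N) (AdeleRing (𝓞 L) L)) : ℝ)) * ∏ᶠ v, (GLn.localHeight N L v (((g : GL (Fin N) (AdeleRing (𝓞 L) L)))⁻¹ * y) : ℝ) := by
        have := GLn.finprod_localHeight_mul_le (g : GL (Fin N) (AdeleRing (𝓞 L) L)) (((g : GL (Fin N) (AdeleRing (𝓞 L) L)))⁻¹ * y)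
        rwa [← hy] at this
      have h2 : ∏ᶠ v, (GLn.localHeight N L v (g : GL (Fin N) (AdeleRing (𝓞 L) L)) : ℝ) ≤ N * T :=
        (finprod_localHeight_le_mul_adelicHeightGL _).trans (mul_le_mul_of_nonneg_left hgT hN0)
      have h3 : ∏ᶠ v, (GLn.localHeight N L v (((g : GL (Fin N) (AdeleRing (𝓞 L) L)))⁻¹ * y) : ℝ) ≤ Bfin := hBfin' _ hω
      calc ∏ᶠ v, (GLn.localHeight N L v y : ℝ)
          ≤ (∏ᶠ v, (GLn.localHeight N L v (g : GL (Fin N) (AdeleRing (𝓞 L) L)) : ℝ)) * ∏ᶠ v, (GLn.localHeight N L v (((g : GL (Fin N) (AdeleRing (𝓞 L) L)))⁻¹ * y) : ℝ) := h1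
        _ ≤ (N * T) * Bfin := mul_le_mul h2 h3 (finprod_nonneg fun _ => NNReal.coe_nonneg _) (by positivity)
        _ = N * Bfin * T := by ring
  -- the smearing inequality and the division by `μ(Ω)`
  have hmain := mul_measure_le_of_smearing ν μ hS hE hκ hm hD
  -- `μ Ω * ν E ≤ ν R * μ D`
  calc ν E = (μ Ω * ν E) / μ Ω := by rw [mul_comm, ENNReal.mul_div_cancel_right hκpos hκfin]
    _ ≤ (ν R * μ D) / μ Ω := ENNReal.div_le_div_right hmain _
    _ = ν R / μ Ω * μ D := ENNReal.mul_div_right_comm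

end Summit.HodgeConjecture.HodgeConjecture.Cruxes.HLiu418.K2LiuClosedSubgroupHeightBallVolume

end
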